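import Summits.ResolutionOfSingularities.ResolutionOfSingularities.Theorems.WeightedInvariantHypersurfaceLocalGameEFT4S
import Summits.ResolutionOfSingularities.ResolutionOfSingularities.Theorems.WeightedInvariantHypersurfaceLocalGameEFTDimOne
import Summits.ResolutionOfSingularities.ResolutionOfSingularities.Theorems.WeightedInvariantHypersurfaceLocalGameEFTCurveMoveChart
import HarnessLib

/-!
# The DIM-1 RUNG of the registered key H2a⁗-S `LocalWeightedDropEFT4S p` (door `HypersurfaceCentreConstruction`,
# stmt-ResolutionOfSingularities-19897), part 2: the ∀-model open presentation (open″) `JOpenPresentationForallSing` at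
# the CLOSED positions of Krull dimension one, for every `ι` and `J = 𝔪ᵐ`, and for the concrete pair
# (instantiated at `(iotaOrd, (g, m) ↦ (√(g))ᵐ)` in part 3) — with the REPORT FOR THE TYPING on the non-closed dim-1 positions

Topic: `Summits/ResolutionOfSingularities/ResolutionOfSingularities/Theorems`. Helper for the door item
`HypersurfaceCentreConstruction` (stmt-ResolutionOfSingularities-19897, route `WeightedInvariant`), ORDER (o23)(b) of the door
registrar res-L1-w43-plan-1 (2026-08-27T06:29:38Z); parts 1/1b (`…LocalGameEFT4SDimOneGame(Rad).lean`) are (o23)(a). [OURS · L1 W4.3]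
Replaces the role of NO printed item; NOT a statement of the manuscript [claim: Hironaka2017, status: under-review]. AI work,
weaker than expert review.

## What is proved (def-free)

* `jOpenPresentationForallSing_dimOne_of_isMaximal` — the body of (open″) `JOpenPresentationForallSing p ι J` at the CLOSED
  dim-1 positions, for every `ι` and every `J` with `J R g m = 𝔪_R ^ m` at the non-zero non-units of discrete valuation rings: `A` Noetherian, `𝔪` MAXIMAL with `A_𝔪`
  regular of Krull dimension `1`, `F ∈ A` with `0 ≠ F ∈ 𝔪² A_𝔪`. ELEMENTARY ROUTE (no dimension theory of finite-type
  algebras): pick `g ∈ A` mapping to a uniformiser of `A_𝔪` (`U = (g)`, `W = (1)`, cotangent image a basis vector of the line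
  `𝔪/𝔪²`); since `𝔪 A_𝔪 = g A_𝔪` and `𝔪` is finitely generated there is `h₁ ∉ 𝔪` with `h₁ · 𝔪 ⊆ (g)`, so on `D(h₁)` a prime
  containing `g` contains `𝔪`, i.e. EQUALS `𝔪` (maximality) — `V(g) ∩ D(h₁) = {𝔪}` without any «`A_h` is a one-dimensional
  domain» lemma; from `F = υ g'ⁿ` in `A_𝔪` a second `h₂ ∉ 𝔪` makes `F` a UNIT at every prime of `D(h₂)` not containing `g`;
  with `h = h₁ h₂` the stratum iff reads `g ∈ 𝔮 ↔ (F ∈ 𝔪_𝔮² ∧ ι(A_𝔮, F) = ι(A_𝔪, F))` — `→` because `𝔮 = 𝔪`, `←` because off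
  `V(g)` the element `F` is a unit — and the presentation at `𝔮 = 𝔪` is
  `J(A_𝔪) F m = (𝔪 A_𝔪)ᵐ = (g'ᵐ) = (weightedMonomialIdeal (g) (1) m)·A_𝔪`.
* `jOpenPresentationForallSing_dimOne` — the same over the clause's own telescope (`k₀` perfect of characteristic `p`, `A` of
  finite type over `k₀`, hence Noetherian) plus `𝔪.IsMaximal` and `ringKrullDim A_𝔪 = 1`;
  the concrete pair `(iotaOrd, (g, m) ↦ (√(g))ᵐ)` of part 1b (res-L1-w43-plan-1 RULINGS gen 8 #1 (ii), adopting res-type-061's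
  `J`; `jRad_eq_pow_maximalIdeal` p510636 discharges the `J`-hypothesis) is instantiated in part 3
  (`…LocalGameEFT4SDimOneConcrete.lean`, filed separately so that this file depends on served oleans only).

## REPORT FOR THE TYPING (the purpose of (o23): «a typing defect in TP5′/TP5″ surfaces now rather than in [S4]»)

(open″) quantifies over ALL primes `𝔪` of the model with `A_𝔪` regular — at a dim-1 position that is NOT closed (`𝔪` the
generic point of a curve `C = V(𝔪)` on a component of `Spec A` of dimension ≥ 2) every basic open `D(h) ∋ 𝔪` contains
infinitely many CLOSED points `𝔮 ⊋ 𝔪`, all with `g ∈ 𝔮`, so the clause there demands `F ∈ 𝔪_𝔮²`, `ι(A_𝔮, F) = ι(A_𝔪, F)`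
and `J(A_𝔮, F, m) = (gᵐ)·A_𝔮` at LOCAL RINGS OF DIMENSION ≥ 2 — it is not a statement about dimension-one local rings.
For `J = 𝔪ᵐ` the presentation part FAILS as typed at such `𝔮` (`𝔪_𝔮ᵐ ≠ (gᵐ)A_𝔮`; res-type-061 / RULINGS gen 8 #1 (ii)), whence
the adopted `J = (√(F))ᵐ`, for which it HOLDS elementarily on `D(h₁ h₂)` (there `(F)A_𝔮 = (gⁿ)A_𝔮` and `(g)A_𝔮 = 𝔪A_𝔮` is prime,
so `√(F)A_𝔮 = (g)A_𝔮`) — the single remaining input at a non-closed position is the `ι`-part, GENERIC EQUIMULTIPLICITY of `F`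
along `C`: `∃ h ∉ 𝔪, ∀ 𝔮 ⊇ 𝔪 prime, h ∉ 𝔮 → iotaOrd (A_𝔮) F = iotaOrd (A_𝔪) F` (for `ord`: shrink `D(h)` into the regular locus of
`A` — tree `RegularLocusPerfectField.isOpen_regularLocus_of_perfectField`, `k₀` perfect — and off the closed super-level set
`{ord ≥ n + 1}` of the u.s.c. order function, (c8)), an L-sized geometric input recorded as the exact missing signature. Hence
this rung covers the CLOSED dim-1 positions hypothesis-free; whether (open″) should quantify over closed points only (the
assembly reads `𝔪 :=` «the prime of a point of the maximum locus») is the registrar's call.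

## References

* H. Matsumura, *Commutative Ring Theory*, Thm. 11.2 (regular local of dimension one = DVR). [Matsumura1987]
-/

noncomputable section

open IsLocalRing Literature.AlgebraicGeometry.Resolution
open LaurentPolynomial
open scoped LaurentPolynomial
open Summit.ResolutionOfSingularities.ResolutionOfSingularities.Cruxes.HypersurfaceCentreConstruction.LocalEngine

set_option linter.dupNamespace false -- mandated namespace of this single-conjunct summit

namespace Summit.ResolutionOfSingularities.ResolutionOfSingularities.Theorems


/-! ## (b) The ∀-model open presentation (open″) at the CLOSED positions of Krull dimension one -/

/-- **(open″) `JOpenPresentationForallSing` at a CLOSED dim-1 position** — for every `ι` and every `J` that is `𝔪ᵐ` at the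
non-zero non-units of discrete valuation rings. `A` Noetherian, `𝔪` MAXIMAL with `A_𝔪` regular of Krull dimension `1`, `0 ≠ F ∈ 𝔪² A_𝔪`: with `g ∈ A` mapping to a
uniformiser of `A_𝔪` (`U = (g)`, `W = (1)`; cotangent image non-zero), `h₁ ∉ 𝔪` with `h₁·𝔪 ⊆ (g)` (finite generation of `𝔪`
and `𝔪 A_𝔪 = g A_𝔪`) and `h₂ ∉ 𝔪` making `F` a unit off `V(g)` (from `F = υ g'ⁿ` in `A_𝔪`), the element `h = h₁ h₂` gives on
`D(h)`: `g ∈ 𝔮 ↔ 𝔮 = 𝔪 ↔ (F ∈ 𝔪_𝔮² ∧ ι(A_𝔮, F) = ι(A_𝔪, F))`, and at `𝔮 = 𝔪` the presentation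
`J(A_𝔪) F m = (𝔪 A_𝔪)ᵐ = ((gᵐ))·A_𝔪 = (weightedMonomialIdeal (g) (1) m)·A_𝔪`. No dimension theory of finite-type algebras
is used. [OURS · L1 W4.3 · (o23)(b) dim-1 rung of H2a⁗-S, closed positions] -/
theorem jOpenPresentationForallSing_dimOne_of_isMaximal
    (ι : (R : Type) → [CommRing R] → R → Ordinal.{0})
    (J : (R : Type) → [CommRing R] → R → ℕ → Ideal R)
    (hJ : ∀ (R : Type) [CommRing R] [IsDomain R] [IsDiscreteValuationRing R] (g : R),
      g ≠ 0 → g ∈ maximalIdeal R → ∀ m : ℕ, J R g m = (maximalIdeal R) ^ m)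
    (A : Type) [CommRing A] [IsNoetherianRing A] (𝔪 : Ideal A) [𝔪.IsMaximal] (F : A)
    (hreg : IsRegularLocalRing (Localization.AtPrime 𝔪)) (hdim : ringKrullDim (Localization.AtPrime 𝔪) = 1)
    (hF0 : algebraMap A (Localization.AtPrime 𝔪) F ≠ 0)
    (hF2 : algebraMap A (Localization.AtPrime 𝔪) F ∈ (maximalIdeal (Localization.AtPrime 𝔪)) ^ 2) :
    ∃ h : A, h ∉ 𝔪 ∧ ∃ (N : ℕ) (U : Fin N → A) (W : Fin N → ℕ), (∀ i, 0 < W i) ∧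
      (∃ hU : ∀ i, algebraMap A (Localization.AtPrime 𝔪) (U i) ∈ maximalIdeal (Localization.AtPrime 𝔪),
        LinearIndependent (ResidueField (Localization.AtPrime 𝔪))
          (fun i => ((maximalIdeal (Localization.AtPrime 𝔪)).toCotangent ⟨_, hU i⟩ :
            CotangentSpace (Localization.AtPrime 𝔪)))) ∧
      ∀ (𝔮 : Ideal A) [𝔮.IsPrime], h ∉ 𝔮 →
        ((∀ i, U i ∈ 𝔮) ↔
          (algebraMap A (Localization.AtPrime 𝔮) F ∈ (maximalIdeal (Localization.AtPrime 𝔮)) ^ 2 ∧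
            ι (Localization.AtPrime 𝔮) (algebraMap A (Localization.AtPrime 𝔮) F) =
              ι (Localization.AtPrime 𝔪) (algebraMap A (Localization.AtPrime 𝔪) F))) ∧
        ((∀ i, U i ∈ 𝔮) → ∀ m : ℕ,
          J (Localization.AtPrime 𝔮) (algebraMap A (Localization.AtPrime 𝔮) F) m =
            (weightedMonomialIdeal U W m).map (algebraMap A (Localization.AtPrime 𝔮))) := by
  classical
  haveI := hreg
  haveI := isDomain_of_isRegularLocalRing (Localization.AtPrime 𝔪)
  haveI : IsDiscreteValuationRing (Localization.AtPrime 𝔪) :=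
    Literature.RingTheory.RegularLocalRing.isDiscreteValuationRing_of_ringKrullDim_eq_one hdim
  -- a uniformiser of `A_𝔪` coming from `A`
  obtain ⟨ϖ, hirr⟩ := IsDiscreteValuationRing.exists_irreducible (Localization.AtPrime 𝔪)
  obtain ⟨⟨g, s⟩, hgs⟩ := IsLocalization.surj 𝔪.primeCompl ϖ
  have hsu : IsUnit (algebraMap A (Localization.AtPrime 𝔪) (s : A)) :=
    IsLocalization.map_units (Localization.AtPrime 𝔪) s
  have hirr' : Irreducible (algebraMap A (Localization.AtPrime 𝔪) g) := by
    have h : algebraMap A (Localization.AtPrime 𝔪) g = ϖ * algebraMap A (Localization.AtPrime 𝔪) (s : A) := hgs.symm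
    rw [h]
    exact (irreducible_mul_isUnit hsu).mpr hirr
  have h𝔪S : maximalIdeal (Localization.AtPrime 𝔪) = Ideal.span {algebraMap A (Localization.AtPrime 𝔪) g} :=
    (IsDiscreteValuationRing.irreducible_iff_uniformizer _).mp hirr'
  have hgm : algebraMap A (Localization.AtPrime 𝔪) g ∈ maximalIdeal (Localization.AtPrime 𝔪) := by
    rw [h𝔪S]; exact Ideal.mem_span_singleton_self _
  -- `F = υ g'ⁿ`
  obtain ⟨n, υ, hFυ⟩ := IsDiscreteValuationRing.eq_unit_mul_pow_irreducible hF0 hirr'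
  -- every `x ∈ 𝔪` is multiplied into `(g)` by some `c ∉ 𝔪`
  have key1 : ∀ x ∈ 𝔪, ∃ c ∉ 𝔪, c * x ∈ Ideal.span {g} := by
    intro x hx
    have hxS : algebraMap A (Localization.AtPrime 𝔪) x ∈ Ideal.span {algebraMap A (Localization.AtPrime 𝔪) g} := by
      rw [← h𝔪S]
      exact (IsLocalization.AtPrime.to_map_mem_maximal_iff (Localization.AtPrime 𝔪) 𝔪 x).mpr hx
    obtain ⟨q, hq⟩ := Ideal.mem_span_singleton'.mp hxS
    obtain ⟨⟨b, t⟩, hbt⟩ := IsLocalization.surj 𝔪.primeCompl q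
    have heq : algebraMap A (Localization.AtPrime 𝔪) (x * t) = algebraMap A (Localization.AtPrime 𝔪) (b * g) := by
      rw [map_mul, map_mul, ← hq, ← hbt]
      ring
    obtain ⟨c, hc⟩ := IsLocalization.exists_of_eq (M := 𝔪.primeCompl) heq
    refine ⟨c * t, fun hmem => ?_, ?_⟩
    · rcases Ideal.IsPrime.mem_or_mem inferInstance hmem with h | h
      · exact c.2 h
      · exact t.2 h
    · rw [show (c : A) * t * x = c * (x * t) by ring, hc]
      exact Ideal.mul_mem_left _ _ (Ideal.mul_mem_left _ _ (Ideal.mem_span_singleton_self g))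
  -- finite generation of `𝔪`: ONE `h₁ ∉ 𝔪` for all generators
  obtain ⟨T, hT⟩ := (IsNoetherian.noetherian 𝔪 : (𝔪 : Submodule A A).FG)
  have hTsub : ∀ x ∈ T, x ∈ 𝔪 := fun x hx => hT ▸ Ideal.subset_span hx
  have key2 : ∀ T' : Finset A, (∀ x ∈ T', x ∈ 𝔪) → ∃ c ∉ 𝔪, ∀ x ∈ T', c * x ∈ Ideal.span {g} := by
    intro T'
    induction T' using Finset.induction_on with
    | empty => exact fun _ => ⟨1, fun h1 => Ideal.IsPrime.ne_top inferInstance ((Ideal.eq_top_iff_one _).mpr h1),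
        fun x hx => absurd hx (Finset.notMem_empty x)⟩
    | insert x T'' hxT ih =>
      intro hsub
      obtain ⟨c₀, hc₀, hc₀T⟩ := ih fun y hy => hsub y (Finset.mem_insert_of_mem hy)
      obtain ⟨c₁, hc₁, hc₁x⟩ := key1 x (hsub x (Finset.mem_insert_self x T''))
      refine ⟨c₁ * c₀, fun hmem => ?_, fun y hy => ?_⟩
      · rcases Ideal.IsPrime.mem_or_mem inferInstance hmem with h | h
        · exact hc₁ h
        · exact hc₀ h
      · rcases Finset.mem_insert.mp hy with rfl | hy'
        · rw [show c₁ * c₀ * y = c₀ * (c₁ * y) by ring]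
          exact Ideal.mul_mem_left _ _ hc₁x
        · rw [mul_assoc]
          exact Ideal.mul_mem_left _ _ (hc₀T y hy')
  obtain ⟨h₁, hh₁, hh₁T⟩ := key2 T hTsub
  -- on `D(h₁)`, a prime containing `g` is `𝔪`
  have hV : ∀ (𝔮 : Ideal A) [𝔮.IsPrime], h₁ ∉ 𝔮 → g ∈ 𝔮 → 𝔪 = 𝔮 := by
    intro 𝔮 _ hh₁𝔮 hg𝔮
    have hle : 𝔪 ≤ 𝔮 := by
      rw [← hT, Ideal.span_le]
      intro x hx
      have hcx : h₁ * x ∈ 𝔮 := (Ideal.span_singleton_le_iff_mem _).mpr hg𝔮 (hh₁T x hx)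
      rcases Ideal.IsPrime.mem_or_mem inferInstance hcx with h | h
      · exact absurd h hh₁𝔮
      · exact h
    exact Ideal.IsMaximal.eq_of_le inferInstance (Ideal.IsPrime.ne_top inferInstance) hle
  -- `h₂ ∉ 𝔪` making `F` a unit off `V(g)`
  obtain ⟨⟨b, t⟩, hbt⟩ := IsLocalization.surj 𝔪.primeCompl (υ : Localization.AtPrime 𝔪)
  have hbm : b ∉ 𝔪 := by
    intro hb
    have hbS : algebraMap A (Localization.AtPrime 𝔪) b ∈ maximalIdeal (Localization.AtPrime 𝔪) :=
      (IsLocalization.AtPrime.to_map_mem_maximal_iff (Localization.AtPrime 𝔪) 𝔪 b).mpr hb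
    have hbu : IsUnit (algebraMap A (Localization.AtPrime 𝔪) b) := by
      rw [← hbt]
      exact υ.isUnit.mul (IsLocalization.map_units (Localization.AtPrime 𝔪) t)
    exact (mem_nonunits_iff.mp ((IsLocalRing.mem_maximalIdeal _).mp hbS)) hbu
  have heqF : algebraMap A (Localization.AtPrime 𝔪) (F * t) = algebraMap A (Localization.AtPrime 𝔪) (b * g ^ n) := by
    rw [map_mul, map_mul, map_pow, hFυ, ← hbt]
    ring
  obtain ⟨d, hd⟩ := IsLocalization.exists_of_eq (M := 𝔪.primeCompl) heqF
  set h₂ : A := d * t * b with hh₂def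
  have hh₂ : h₂ ∉ 𝔪 := by
    intro hmem
    rcases Ideal.IsPrime.mem_or_mem inferInstance hmem with h | h
    · rcases Ideal.IsPrime.mem_or_mem inferInstance h with h' | h'
      · exact d.2 h'
      · exact t.2 h'
    · exact hbm h
  have hunitF : ∀ (𝔮 : Ideal A) [𝔮.IsPrime], h₂ ∉ 𝔮 → g ∉ 𝔮 →
      IsUnit (algebraMap A (Localization.AtPrime 𝔮) F) := by
    intro 𝔮 _ hh₂𝔮 hg𝔮
    have hd𝔮 : (d : A) ∉ 𝔮 := fun h => hh₂𝔮 (by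
      rw [hh₂def, mul_assoc]; exact Ideal.mul_mem_right _ _ h)
    have ht𝔮 : (t : A) ∉ 𝔮 := fun h => hh₂𝔮 (by
      rw [hh₂def, mul_comm (d : A) t, mul_assoc]; exact Ideal.mul_mem_right _ _ h)
    have hb𝔮 : b ∉ 𝔮 := fun h => hh₂𝔮 (Ideal.mul_mem_left _ _ h)
    have hunit : ∀ y : A, y ∉ 𝔮 → IsUnit (algebraMap A (Localization.AtPrime 𝔮) y) := fun y hy =>
      IsLocalization.map_units (Localization.AtPrime 𝔮) (⟨y, hy⟩ : 𝔮.primeCompl)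
    have hprod : IsUnit (algebraMap A (Localization.AtPrime 𝔮) ((d : A) * (F * t))) := by
      rw [hd, map_mul, map_mul, map_pow]
      exact (hunit _ hd𝔮).mul ((hunit _ hb𝔮).mul ((hunit _ hg𝔮).pow n))
    rw [map_mul, map_mul] at hprod
    exact isUnit_of_mul_isUnit_left (isUnit_of_mul_isUnit_right hprod)
  -- the data
  refine ⟨h₁ * h₂, fun hmem => ?_, 1, fun _ => g, fun _ => 1, fun _ => Nat.one_pos, ⟨fun _ => hgm, ?_⟩, ?_⟩
  · rcases Ideal.IsPrime.mem_or_mem inferInstance hmem with h | h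
    · exact hh₁ h
    · exact hh₂ h
  · -- the cotangent image of the uniformiser is non-zero
    rw [linearIndependent_unique_iff]
    intro hzero
    rw [Ideal.toCotangent_eq_zero] at hzero
    change algebraMap A (Localization.AtPrime 𝔪) g ∈ maximalIdeal (Localization.AtPrime 𝔪) ^ 2 at hzero
    rw [h𝔪S, Ideal.span_singleton_pow, Ideal.mem_span_singleton] at hzero
    obtain ⟨c, hc⟩ := hzero
    apply hirr'.not_isUnit
    refine isUnit_iff_exists_inv.mpr ⟨c, mul_left_cancel₀ hirr'.ne_zero ?_⟩
    rw [mul_one, ← mul_assoc, ← pow_two]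
    exact hc.symm
  · intro 𝔮 _ hh𝔮
    have hh₁𝔮 : h₁ ∉ 𝔮 := fun h => hh𝔮 (Ideal.mul_mem_right _ _ h)
    have hh₂𝔮 : h₂ ∉ 𝔮 := fun h => hh𝔮 (Ideal.mul_mem_left _ _ h)
    refine ⟨⟨fun hU => ?_, fun hrhs => ?_⟩, fun hU m' => ?_⟩
    · -- `g ∈ 𝔮` ⇒ `𝔮 = 𝔪`
      have h𝔪𝔮 := hV 𝔮 hh₁𝔮 (hU 0)
      subst h𝔪𝔮
      exact ⟨hF2, rfl⟩
    · -- off `V(g)` the element `F` is a unit, so `F ∉ 𝔪_𝔮²`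
      intro _
      by_contra hg𝔮
      have hu := hunitF 𝔮 hh₂𝔮 hg𝔮
      have hmem : algebraMap A (Localization.AtPrime 𝔮) F ∈ maximalIdeal (Localization.AtPrime 𝔮) :=
        Ideal.pow_le_self two_ne_zero hrhs.1
      exact (mem_nonunits_iff.mp ((IsLocalRing.mem_maximalIdeal _).mp hmem)) hu
    · -- presentation at `𝔮 = 𝔪`
      have h𝔪𝔮 := hV 𝔮 hh₁𝔮 (hU 0)
      subst h𝔪𝔮
      rw [hJ (Localization.AtPrime 𝔪) _ hF0 (Ideal.pow_le_self two_ne_zero hF2) m', h𝔪S, Ideal.span_singleton_pow,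
        LocalGameEFTCurveMove.weightedMonomialIdeal_one_eq, Ideal.map_span, Set.image_singleton, map_pow]

/-- **(open″) at the closed dim-1 positions, over the clause's own telescope** (`k₀` perfect of characteristic `p`, `A` of
finite type over `k₀` — hence Noetherian —, `𝔪` a prime with `A_𝔪` regular; plus `𝔪` MAXIMAL and `ringKrullDim A_𝔪 = 1`).
[OURS · L1 W4.3 · (o23)(b)] -/
theorem jOpenPresentationForallSing_dimOne (p : ℕ)
    (ι : (R : Type) → [CommRing R] → R → Ordinal.{0})
    (J : (R : Type) → [CommRing R] → R → ℕ → Ideal R)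
    (hJ : ∀ (R : Type) [CommRing R] [IsDomain R] [IsDiscreteValuationRing R] (g : R),
      g ≠ 0 → g ∈ maximalIdeal R → ∀ m : ℕ, J R g m = (maximalIdeal R) ^ m)
    (k₀ : Type) [Field k₀] [CharP k₀ p] [PerfectField k₀]
    (A : Type) [CommRing A] [Algebra k₀ A] [Algebra.FiniteType k₀ A] (𝔪 : Ideal A) [𝔪.IsPrime] (F : A)
    (hmax : 𝔪.IsMaximal) (hreg : IsRegularLocalRing (Localization.AtPrime 𝔪))
    (hdim : ringKrullDim (Localization.AtPrime 𝔪) = 1)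
    (hF0 : algebraMap A (Localization.AtPrime 𝔪) F ≠ 0)
    (hF2 : algebraMap A (Localization.AtPrime 𝔪) F ∈ (maximalIdeal (Localization.AtPrime 𝔪)) ^ 2) :
    ∃ h : A, h ∉ 𝔪 ∧ ∃ (N : ℕ) (U : Fin N → A) (W : Fin N → ℕ), (∀ i, 0 < W i) ∧
      (∃ hU : ∀ i, algebraMap A (Localization.AtPrime 𝔪) (U i) ∈ maximalIdeal (Localization.AtPrime 𝔪),
        LinearIndependent (ResidueField (Localization.AtPrime 𝔪))
          (fun i => ((maximalIdeal (Localization.AtPrime 𝔪)).toCotangent ⟨_, hU i⟩ :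
            CotangentSpace (Localization.AtPrime 𝔪)))) ∧
      ∀ (𝔮 : Ideal A) [𝔮.IsPrime], h ∉ 𝔮 →
        ((∀ i, U i ∈ 𝔮) ↔
          (algebraMap A (Localization.AtPrime 𝔮) F ∈ (maximalIdeal (Localization.AtPrime 𝔮)) ^ 2 ∧
            ι (Localization.AtPrime 𝔮) (algebraMap A (Localization.AtPrime 𝔮) F) =
              ι (Localization.AtPrime 𝔪) (algebraMap A (Localization.AtPrime 𝔪) F))) ∧
        ((∀ i, U i ∈ 𝔮) → ∀ m : ℕ,
          J (Localization.AtPrime 𝔮) (algebraMap A (Localization.AtPrime 𝔮) F) m =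
            (weightedMonomialIdeal U W m).map (algebraMap A (Localization.AtPrime 𝔮))) := by
  haveI : IsNoetherianRing A := Algebra.FiniteType.isNoetherianRing k₀ A
  haveI := hmax
  have _unused : CharP k₀ p ∧ PerfectField k₀ := ⟨inferInstance, inferInstance⟩
  exact jOpenPresentationForallSing_dimOne_of_isMaximal ι J hJ A 𝔪 F hreg hdim hF0 hF2

end Summit.ResolutionOfSingularities.ResolutionOfSingularities.Theorems

end
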